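import Summits.AtomisticToContinuum.Crystallization.Theorems.DisclinationRationUniformPolytypeStabilityNearCellsAux

/-!
# `UniformPolytypeStability` (stmt-AtomisticToContinuum-15800), line `birth` (v2, cells): stub `stub_nearCells`

Route `DisclinationRation`, crux `UniformPolytypeStability` (uniform harmonic stability of Lennard-Jones layered
polytypes `L(a,s,z)` on the box `a ∈ [47/50, 1]`, gaps in `[39a/50, 17a/20]`), line `birth`
(lead prover-line-stmt-AtomisticToContinuum-15800-0).  This `--supports` file (2/2, after the generic helpers of
`…Theorems.DisclinationRationUniformPolytypeStabilityNearCellsAux`) proves the registered stub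

  `stub_nearCells : ∀ a s z, 47/50 ≤ a → a ≤ 1 → IsHaggSeq s → HeightBox a z → SitesFacts a s z →
     NearCellFacts a s z`

over the line vocabulary `…Theorems.DisclinationRationUniformPolytypeStabilityDefs`: for a finitely supported
displacement `U : Idx → E3` the cell functionals `cellHess`, `cellNN` are finitely supported in the cell index, the
near pair terms `nearTerm`, `nnTermC` are summable over `Idx × Idx`, and

  `∑' nearTerm U = 2 · ∑'_cells cellHess U`,   `∑' nnTermC U = 2 · ∑'_cells cellNN U`.

This is combinatorial share bookkeeping plus `tsum` algebra; the geometry enters only through `pos` inside the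
symmetric pair functional `T x y = (U x − U y)ᵀ K(pos x − pos y) (U x − U y)` (`K(−e) = K(e)`,
`Hess₀_neg_left/right`), which is never evaluated; of the box hypotheses only `IsHaggSeq s` (`s = ±1`) is used.

* `nearPair_iff'`, `nnPair_iff'`: the shells with the layer condition as `y.1 − x.1 ∈ {0, 1, −1}` and the letter
  of the lower layer read from `x`;
* `nearPair_iff_mem`, `nnPair_iff_mem`, `nodup_near`, `nodup_nn`: for `s = ±1`, `NearPair s x ·` (resp.
  `NNPair s x ·`) is exactly the duplicate-free list of the 18 (resp. 12) twisted shifts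
  `(x.1 + dz, x.2.1 + s(x.1 − e)·dx, x.2.2 + s(x.1 − e)·dy)`, `(e, dz, dx, dy)` in an explicit list
  (reduced to offsets in `{−1,0,1}³` and decided);
* `near_assembly`, `nn_assembly`: the share bookkeeping of `bondTable` for an abstract class functional `B` that is
  reversal-invariant and twist-blind in-plane: each unordered near pair is a row of the cells containing it with
  shares summing to one (rhombus sides and vertical edges `4 × 1/4`, short and slant diagonals `2 × 1/2`,
  octahedron diagonals `1`);
* `stub_nearCells`: pair side by `StubNearCells.tsum_pairs`, cell side by `StubNearCells.tsum_cellSum`, glued by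
  the assembly identities with `B e dz dx dy = ∑' x, T x (shift x)` (`tsum_shift_swap`, `tsum_shift_untwist`).

Everything is `[folklore]`; no definitions; helper lemmas live in the sub-namespace `StubNearCells`; nothing here
closes an item.
-/

noncomputable section

namespace Summit.AtomisticToContinuum.Crystallization.Theorems.UniformPolytypeStabilityCells

open scoped BigOperators Topology Classical InnerProductSpace
open Filter Set Function
open Literature.MathematicalPhysics.StatisticalMechanics
open Summit.AtomisticToContinuum.Crystallization.Theorems.PhononStabilityNegative

namespace StubNearCells

/-! ## Normal forms of the two shells -/

/-- `NNPair` with the layer condition written as `y.1 - x.1 ∈ {0, 1, -1}` and the letter of the lower layer read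
from `x`. [folklore] -/
theorem nnPair_iff' (s : ℤ → ℤ) (x y : Idx) : NNPair s x y ↔
    (y.1 - x.1 = 0 ∧ InPlaneNN (y.2.1 - x.2.1, y.2.2 - x.2.2)) ∨
    (y.1 - x.1 = 1 ∧ UpNN (s x.1) (y.2.1 - x.2.1, y.2.2 - x.2.2)) ∨
    (y.1 - x.1 = -1 ∧ UpNN (s (x.1 - 1)) (x.2.1 - y.2.1, x.2.2 - y.2.2)) := by
  unfold NNPair
  constructor
  · rintro (⟨h, hP⟩ | ⟨h, hP⟩ | ⟨h, hP⟩)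
    · exact Or.inl ⟨by omega, hP⟩
    · exact Or.inr (Or.inl ⟨by omega, hP⟩)
    · refine Or.inr (Or.inr ⟨by omega, ?_⟩)
      rwa [show x.1 - 1 = y.1 by omega]
  · rintro (⟨h, hP⟩ | ⟨h, hP⟩ | ⟨h, hP⟩)
    · exact Or.inl ⟨by omega, hP⟩
    · exact Or.inr (Or.inl ⟨by omega, hP⟩)
    · refine Or.inr (Or.inr ⟨by omega, ?_⟩)
      rwa [show y.1 = x.1 - 1 by omega]

/-- `NearPair` with the layer condition written as `y.1 - x.1 ∈ {0, 1, -1}` and the letter of the lower layer read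
from `x`. [folklore] -/
theorem nearPair_iff' (s : ℤ → ℤ) (x y : Idx) : NearPair s x y ↔
    (y.1 - x.1 = 0 ∧ InPlaneNN (y.2.1 - x.2.1, y.2.2 - x.2.2)) ∨
    (y.1 - x.1 = 1 ∧ (UpNN (s x.1) (y.2.1 - x.2.1, y.2.2 - x.2.2) ∨
      UpDiag (s x.1) (y.2.1 - x.2.1, y.2.2 - x.2.2))) ∨
    (y.1 - x.1 = -1 ∧ (UpNN (s (x.1 - 1)) (x.2.1 - y.2.1, x.2.2 - y.2.2) ∨
      UpDiag (s (x.1 - 1)) (x.2.1 - y.2.1, x.2.2 - y.2.2))) := by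
  unfold NearPair DiagPair
  rw [nnPair_iff']
  constructor
  · rintro ((⟨h, hP⟩ | ⟨h, hP⟩ | ⟨h, hP⟩) | ⟨h, hP⟩ | ⟨h, hP⟩)
    · exact Or.inl ⟨h, hP⟩
    · exact Or.inr (Or.inl ⟨h, Or.inl hP⟩)
    · exact Or.inr (Or.inr ⟨h, Or.inl hP⟩)
    · exact Or.inr (Or.inl ⟨by omega, Or.inr hP⟩)
    · refine Or.inr (Or.inr ⟨by omega, Or.inr ?_⟩)
      rwa [show x.1 - 1 = y.1 by omega]
  · rintro (⟨h, hP⟩ | ⟨h, hP | hP⟩ | ⟨h, hP | hP⟩)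
    · exact Or.inl (Or.inl ⟨h, hP⟩)
    · exact Or.inl (Or.inr (Or.inl ⟨h, hP⟩))
    · exact Or.inr (Or.inl ⟨by omega, hP⟩)
    · exact Or.inl (Or.inr (Or.inr ⟨h, hP⟩))
    · refine Or.inr (Or.inr ⟨by omega, ?_⟩)
      rwa [show y.1 = x.1 - 1 by omega]

/-! ## The 18 near shifts and the 12 nearest-neighbour shifts

A shift is coded `(e, dz, dx, dy) : ℤ × ℤ × ℤ × ℤ`: `y = (x.1 + dz, x.2.1 + σ dx, x.2.2 + σ dy)` with the twist
`σ = s (x.1 - e)` (the letter of the slab below `x` for `e = 1`, of the slab above for `e = 0`). -/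

/-- For letters `s = ±1`: `NearPair s x y` iff `y` is one of the 18 twisted near shifts of `x` (6 upward: vertical,
two slant, three octahedron diagonals; their 6 downward reverses; 6 in-plane).  Reduced to the finitely many
offsets `y - x ∈ {-1,0,1}³` and decided. [folklore] -/
theorem nearPair_iff_mem {s : ℤ → ℤ} (hs : IsHaggSeq s) (x y : Idx) :
    NearPair s x y ↔ y ∈ ([(0, 1, 0, 0), (0, 1, -1, 0), (0, 1, 0, -1), (0, 1, -1, -1), (0, 1, 1, -1),
      (0, 1, -1, 1), (1, -1, 0, 0), (1, -1, 1, 0), (1, -1, 0, 1), (1, -1, 1, 1), (1, -1, -1, 1), (1, -1, 1, -1),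
      (0, 0, 1, 0), (0, 0, -1, 0), (0, 0, 0, 1), (0, 0, 0, -1), (0, 0, 1, -1), (0, 0, -1, 1)] :
        List (ℤ × ℤ × ℤ × ℤ)).map
      (fun κ => (x.1 + κ.2.1, x.2.1 + s (x.1 - κ.1) * κ.2.2.1, x.2.2 + s (x.1 - κ.1) * κ.2.2.2)) := by
  obtain ⟨m, i, j⟩ := x
  obtain ⟨p, q, r, rfl⟩ : ∃ p q r : ℤ, y = (m + p, i + q, j + r) :=
    ⟨y.1 - m, y.2.1 - i, y.2.2 - j, by ext <;> simp⟩
  rw [nearPair_iff']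
  rcases hs m with h0 | h0 <;> rcases hs (m - 1) with h1 | h1 <;>
  · simp only [InPlaneNN, UpNN, UpDiag, List.map_cons, List.map_nil, List.mem_cons, List.not_mem_nil,
      Prod.mk.injEq, add_sub_cancel_left, sub_add_cancel_left, sub_zero, add_right_inj, or_false, h0, h1]
    norm_num
    by_cases hb : (p = -1 ∨ p = 0 ∨ p = 1) ∧ (q = -1 ∨ q = 0 ∨ q = 1) ∧ (r = -1 ∨ r = 0 ∨ r = 1)
    · obtain ⟨hp, hq, hr⟩ := hb
      rcases hp with rfl | rfl | rfl <;> rcases hq with rfl | rfl | rfl <;>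
        rcases hr with rfl | rfl | rfl <;> norm_num
    · constructor <;> intro h <;> exact (hb (by omega)).elim

/-- For letters `s = ±1` the 18 near shifts of a site are pairwise distinct. [folklore] -/
theorem nodup_near {s : ℤ → ℤ} (hs : IsHaggSeq s) (x : Idx) :
    (([(0, 1, 0, 0), (0, 1, -1, 0), (0, 1, 0, -1), (0, 1, -1, -1), (0, 1, 1, -1),
      (0, 1, -1, 1), (1, -1, 0, 0), (1, -1, 1, 0), (1, -1, 0, 1), (1, -1, 1, 1), (1, -1, -1, 1), (1, -1, 1, -1),
      (0, 0, 1, 0), (0, 0, -1, 0), (0, 0, 0, 1), (0, 0, 0, -1), (0, 0, 1, -1), (0, 0, -1, 1)] :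
        List (ℤ × ℤ × ℤ × ℤ)).map
      (fun κ => (x.1 + κ.2.1, x.2.1 + s (x.1 - κ.1) * κ.2.2.1, x.2.2 + s (x.1 - κ.1) * κ.2.2.2))).Nodup := by
  obtain ⟨m, i, j⟩ := x
  rcases hs m with h0 | h0 <;> rcases hs (m - 1) with h1 | h1 <;> simp [h0, h1, List.nodup_cons]

/-- For letters `s = ±1`: `NNPair s x y` iff `y` is one of the 12 twisted nearest-neighbour shifts of `x`
(3 upward, their 3 downward reverses, 6 in-plane). [folklore] -/
theorem nnPair_iff_mem {s : ℤ → ℤ} (hs : IsHaggSeq s) (x y : Idx) :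
    NNPair s x y ↔ y ∈ ([(0, 1, 0, 0), (0, 1, -1, 0), (0, 1, 0, -1), (1, -1, 0, 0), (1, -1, 1, 0), (1, -1, 0, 1),
      (0, 0, 1, 0), (0, 0, -1, 0), (0, 0, 0, 1), (0, 0, 0, -1), (0, 0, 1, -1), (0, 0, -1, 1)] :
        List (ℤ × ℤ × ℤ × ℤ)).map
      (fun κ => (x.1 + κ.2.1, x.2.1 + s (x.1 - κ.1) * κ.2.2.1, x.2.2 + s (x.1 - κ.1) * κ.2.2.2)) := by
  obtain ⟨m, i, j⟩ := x
  obtain ⟨p, q, r, rfl⟩ : ∃ p q r : ℤ, y = (m + p, i + q, j + r) :=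
    ⟨y.1 - m, y.2.1 - i, y.2.2 - j, by ext <;> simp⟩
  rw [nnPair_iff']
  rcases hs m with h0 | h0 <;> rcases hs (m - 1) with h1 | h1 <;>
  · simp only [InPlaneNN, UpNN, List.map_cons, List.map_nil, List.mem_cons, List.not_mem_nil,
      Prod.mk.injEq, add_sub_cancel_left, sub_add_cancel_left, sub_zero, add_right_inj, or_false, h0, h1]
    norm_num
    by_cases hb : (p = -1 ∨ p = 0 ∨ p = 1) ∧ (q = -1 ∨ q = 0 ∨ q = 1) ∧ (r = -1 ∨ r = 0 ∨ r = 1)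
    · obtain ⟨hp, hq, hr⟩ := hb
      rcases hp with rfl | rfl | rfl <;> rcases hq with rfl | rfl | rfl <;>
        rcases hr with rfl | rfl | rfl <;> norm_num
    · constructor <;> intro h <;> exact (hb (by omega)).elim

/-- For letters `s = ±1` the 12 nearest-neighbour shifts of a site are pairwise distinct (a sublist of the 18 near
shifts). [folklore] -/
theorem nodup_nn {s : ℤ → ℤ} (hs : IsHaggSeq s) (x : Idx) :
    (([(0, 1, 0, 0), (0, 1, -1, 0), (0, 1, 0, -1), (1, -1, 0, 0), (1, -1, 1, 0), (1, -1, 0, 1),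
      (0, 0, 1, 0), (0, 0, -1, 0), (0, 0, 0, 1), (0, 0, 0, -1), (0, 0, 1, -1), (0, 0, -1, 1)] :
        List (ℤ × ℤ × ℤ × ℤ)).map
      (fun κ => (x.1 + κ.2.1, x.2.1 + s (x.1 - κ.1) * κ.2.2.1, x.2.2 + s (x.1 - κ.1) * κ.2.2.2))).Nodup :=
  (nodup_near hs x).sublist (List.Sublist.map _ (by decide))

/-! ## Share bookkeeping of `bondTable`

For a "class functional" `B e dz dx dy` (the sum of a symmetric pair functional over the twisted offset class
`(dz, dx, dy)` read at slab shift `e`) which is reversal-invariant and twist-blind in-plane, the sum over the near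
(resp. nearest-neighbour) shifts is twice the share-weighted sum over the 21 (resp. 18) rows of `bondTable`: every
unordered bond is a row of the cells containing it with shares adding up to `1`. -/

/-- Near shifts versus all 21 rows of `bondTable` (shares: rhombus sides and vertical edges `4 × 1/4`, short and
slant diagonals `2 × 1/2`, octahedron diagonals `1`). [folklore] -/
theorem near_assembly (B : ℤ → ℤ → ℤ → ℤ → ℝ) (hd : ∀ q r : ℤ, B 1 (-1) q r = B 0 1 (-q) (-r))
    (hn : ∀ q r : ℤ, B 0 0 q r = B 0 0 (-q) (-r)) (he : ∀ q r : ℤ, B 1 0 q r = B 0 0 q r) :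
    (([(0, 1, 0, 0), (0, 1, -1, 0), (0, 1, 0, -1), (0, 1, -1, -1), (0, 1, 1, -1),
      (0, 1, -1, 1), (1, -1, 0, 0), (1, -1, 1, 0), (1, -1, 0, 1), (1, -1, 1, 1), (1, -1, -1, 1), (1, -1, 1, -1),
      (0, 0, 1, 0), (0, 0, -1, 0), (0, 0, 0, 1), (0, 0, 0, -1), (0, 0, 1, -1), (0, 0, -1, 1)] :
        List (ℤ × ℤ × ℤ × ℤ)).map fun κ => B κ.1 κ.2.1 κ.2.2.1 κ.2.2.2).sum =
      2 * (bondTable.map fun b => (b.2.2.1 : ℝ) *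
        B ((b.1.2.2 : ℕ) : ℤ) (((b.2.1.2.2 : ℕ) : ℤ) - ((b.1.2.2 : ℕ) : ℤ))
          (((b.2.1.1 : ℕ) : ℤ) - ((b.1.1 : ℕ) : ℤ)) (((b.2.1.2.1 : ℕ) : ℤ) - ((b.1.2.1 : ℕ) : ℤ))).sum := by
  simp only [bondTable, mkC, List.map_cons, List.map_nil, List.sum_cons, List.sum_nil, Fin.val_zero,
    Fin.val_one, Nat.cast_zero, Nat.cast_one, sub_zero, sub_self, zero_sub]
  rw [hd 0 0, hd 1 0, hd 0 1, hd 1 1, hd (-1) 1, hd 1 (-1), hn (-1) 0, hn 0 (-1), hn 1 (-1), he 1 0, he 0 1,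
    he (-1) 1]
  norm_num
  ring

/-- Nearest-neighbour shifts versus the 18 nearest-neighbour rows of `bondTable` (weight `[isNN] · share`).
[folklore] -/
theorem nn_assembly (B : ℤ → ℤ → ℤ → ℤ → ℝ) (hd : ∀ q r : ℤ, B 1 (-1) q r = B 0 1 (-q) (-r))
    (hn : ∀ q r : ℤ, B 0 0 q r = B 0 0 (-q) (-r)) (he : ∀ q r : ℤ, B 1 0 q r = B 0 0 q r) :
    (([(0, 1, 0, 0), (0, 1, -1, 0), (0, 1, 0, -1), (1, -1, 0, 0), (1, -1, 1, 0), (1, -1, 0, 1),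
      (0, 0, 1, 0), (0, 0, -1, 0), (0, 0, 0, 1), (0, 0, 0, -1), (0, 0, 1, -1), (0, 0, -1, 1)] :
        List (ℤ × ℤ × ℤ × ℤ)).map fun κ => B κ.1 κ.2.1 κ.2.2.1 κ.2.2.2).sum =
      2 * (bondTable.map fun b => (if b.2.2.2 then (b.2.2.1 : ℝ) else 0) *
        B ((b.1.2.2 : ℕ) : ℤ) (((b.2.1.2.2 : ℕ) : ℤ) - ((b.1.2.2 : ℕ) : ℤ))
          (((b.2.1.1 : ℕ) : ℤ) - ((b.1.1 : ℕ) : ℤ)) (((b.2.1.2.1 : ℕ) : ℤ) - ((b.1.2.1 : ℕ) : ℤ))).sum := by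
  simp only [bondTable, mkC, List.map_cons, List.map_nil, List.sum_cons, List.sum_nil, Fin.val_zero,
    Fin.val_one, Nat.cast_zero, Nat.cast_one, sub_zero, sub_self, zero_sub]
  rw [hd 0 0, hd 1 0, hd 0 1, hn (-1) 0, hn 0 (-1), hn 1 (-1), he 1 0, he 0 1, he (-1) 1]
  norm_num
  ring

end StubNearCells

open StubNearCells in
/-- **Stub `stub_nearCells`** (registered signature): on the box, for letters `s = ±1` and a finitely supported
displacement `U` of the site indices, the cell functionals `cellHess`, `cellNN` are finitely supported, the near
pair terms `nearTerm`, `nnTermC` are summable over `Idx × Idx`, and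
`∑' nearTerm = 2 ∑'_cells cellHess`, `∑' nnTermC = 2 ∑'_cells cellNN` (every ordered near pair is a bond of the
cells containing it, with shares summing to one; `K(−e) = K(e)`).  Only `IsHaggSeq s` is used; the metric facts
`SitesFacts` are not needed for this combinatorial regrouping. [folklore] -/
theorem stub_nearCells : ∀ (a : ℝ) (s : ℤ → ℤ) (z : ℤ → ℝ), 47 / 50 ≤ a → a ≤ 1 → IsHaggSeq s →
    HeightBox a z → SitesFacts a s z → NearCellFacts a s z := by
  intro a s z _ _ hs _ _ U hU
  obtain ⟨TH, hTH⟩ : ∃ TH : Idx → Idx → ℝ, ∀ x y, TH x y = Hess₀ (pos a s z x - pos a s z y) (U x - U y) :=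
    ⟨_, fun _ _ => rfl⟩
  obtain ⟨TN, hTN⟩ : ∃ TN : Idx → Idx → ℝ, ∀ x y, TN x y = ‖U x - U y‖ ^ 2 := ⟨_, fun _ _ => rfl⟩
  have hHs : ∀ x y, TH x y = TH y x := fun x y => by
    rw [hTH, hTH, ← Hess₀_neg_left, ← Hess₀_neg_right, neg_sub, neg_sub]
  have hNs : ∀ x y, TN x y = TN y x := fun x y => by rw [hTN, hTN, norm_sub_rev]
  have hH0 : ∀ x y, x ∉ support U → y ∉ support U → TH x y = 0 := fun x y hx hy => by
    rw [notMem_support] at hx hy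
    simp [hTH, hx, hy]
  have hN0 : ∀ x y, x ∉ support U → y ∉ support U → TN x y = 0 := fun x y hx hy => by
    rw [notMem_support] at hx hy
    simp [hTN, hx, hy]
  -- the vocabulary in terms of `TH`, `TN`
  have hnearF : nearTerm a s z U = fun p => if NearPair s p.1 p.2 then TH p.1 p.2 else 0 := by
    funext p; simp only [nearTerm, hTH]
  have hnnF : nnTermC s U = fun p => if NNPair s p.1 p.2 then TN p.1 p.2 else 0 := by
    funext p; simp only [nnTermC, hTN]
  have hcellHF : cellHess a s z U =
      fun ι => (bondTable.map fun b => (b.2.2.1 : ℝ) * TH (cvert s ι b.1) (cvert s ι b.2.1)).sum := by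
    funext ι; simp only [cellHess, hTH]
  have hcellNF : cellNN s U = fun ι =>
      (bondTable.map fun b => (if b.2.2.2 then (b.2.2.1 : ℝ) else 0) * TN (cvert s ι b.1) (cvert s ι b.2.1)).sum := by
    funext ι; simp only [cellNN, hTN, ite_mul, zero_mul]
  -- pair side
  obtain ⟨hsH, htH⟩ := tsum_pairs TH hU hH0 (NearPair s) (nearPair_iff_mem hs) (nodup_near hs)
    fun κ => shift_injective (fun m => s (m - κ.1)) κ.2.1 κ.2.2.1 κ.2.2.2
  obtain ⟨hsN, htN⟩ := tsum_pairs TN hU hN0 (NNPair s) (nnPair_iff_mem hs) (nodup_nn hs)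
    fun κ => shift_injective (fun m => s (m - κ.1)) κ.2.1 κ.2.2.1 κ.2.2.2
  -- share bookkeeping
  have hasmH := near_assembly
    (fun e dz dx dy => ∑' x : Idx, TH x (x.1 + dz, x.2.1 + s (x.1 - e) * dx, x.2.2 + s (x.1 - e) * dy))
    (fun q r => tsum_shift_swap TH hHs s 1 (-1) q r 0 1 (-q) (-r) (by norm_num) (by norm_num) rfl rfl)
    (fun q r => tsum_shift_swap TH hHs s 0 0 q r 0 0 (-q) (-r) (by norm_num) (by norm_num) rfl rfl)
    (fun q r => (tsum_shift_untwist TH hHs hs 1 q r).trans (tsum_shift_untwist TH hHs hs 0 q r).symm)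
  have hasmN := nn_assembly
    (fun e dz dx dy => ∑' x : Idx, TN x (x.1 + dz, x.2.1 + s (x.1 - e) * dx, x.2.2 + s (x.1 - e) * dy))
    (fun q r => tsum_shift_swap TN hNs s 1 (-1) q r 0 1 (-q) (-r) (by norm_num) (by norm_num) rfl rfl)
    (fun q r => tsum_shift_swap TN hNs s 0 0 q r 0 0 (-q) (-r) (by norm_num) (by norm_num) rfl rfl)
    (fun q r => (tsum_shift_untwist TN hNs hs 1 q r).trans (tsum_shift_untwist TN hNs hs 0 q r).symm)
  refine ⟨?_, ?_, ?_, ?_, ?_, ?_⟩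
  · rw [hcellHF]
    exact finite_support_cellSum TH (fun b => (b.2.2.1 : ℝ)) hU hH0 s
  · rw [hcellNF]
    exact finite_support_cellSum TN (fun b => if b.2.2.2 then (b.2.2.1 : ℝ) else 0) hU hN0 s
  · rw [hnearF]
    exact hsH
  · rw [hnnF]
    exact hsN
  · rw [hnearF, hcellHF]
    exact htH.trans (hasmH.trans
      (congrArg (fun t : ℝ => 2 * t) (tsum_cellSum TH (fun b => (b.2.2.1 : ℝ)) hU hH0 s).symm))
  · rw [hnnF, hcellNF]
    exact htN.trans (hasmN.trans (congrArg (fun t : ℝ => 2 * t)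
      (tsum_cellSum TN (fun b => if b.2.2.2 then (b.2.2.1 : ℝ) else 0) hU hN0 s).symm))

end Summit.AtomisticToContinuum.Crystallization.Theorems.UniformPolytypeStabilityCells

end
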